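import Mathlib.Analysis.Complex.AbsMax
import Mathlib.MeasureTheory.Measure.Lebesgue.Basic
import Mathlib.Combinatorics.Pigeonhole
import HarnessLib

/-!
# From shifts of positive lower density to `≫ T` distinct zeros

Topic `Literature/NumberTheory/LFunctions` (namespace `Literature.NumberTheory.LFunctions`). Two
PROVED tools of the "classical way to get zeros off the critical line" (Saias–Weingartner 2009,
§1 and §4; Kaczorowski–Kulas 2007; Titchmarsh §11.10): once a set `A` of shifts `τ` of positive
lower density is known such that for every `τ ∈ A` the function `F` has a zero in the disc
`|s − (σ + i(τ + t₀))| < r`, "by the positive lower density of these `t`, we conclude that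
`N'_F(σ₁, σ₂, T) ≫ T`" ([SaiasWeingartner2009], end of §4).

* `exists_zero_of_norm_sub_lt` — **Rouché's theorem through the maximum modulus principle**
  (the form used with universality): if `g` is holomorphic in `|z − z₀| < r` and continuous on the
  closed disc, `f(z₀) = 0`, `|f| ≥ δ` on the circle `|z − z₀| = r` and `|g − f| < δ/2` on the
  closed disc, then `g` has a zero in the open disc. (Otherwise `1/g` is holomorphic, `|1/g| ≤ 2/δ`
  on the circle, hence at the centre, contradicting `|g(z₀)| = |g(z₀) − f(z₀)| < δ/2`.) Only the
  values of `f` enter; no analyticity of `f` is needed.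
* `exists_finset_zeros_of_density` — **counting**: if `meas(A ∩ [0, T]) ≥ δT` for `T ≥ T₁`
  (`δ > 0`) and every `τ ∈ A` yields a zero `z` of `F` with `|Re z − σ| < r`,
  `|Im z − (τ + t₀)| < r`, then there are `c > 0` and `T₀` such that for all `T ≥ T₀` some finite
  set of at least `cT` DISTINCT zeros of `F` lies in `|Re z − σ| < r`, `|Im z| ≤ T`. (Cut `[0, T]`
  into intervals of length `r`; at least `δT/r − 1` of them meet `A`; a third of those are pairwise
  `≥ 2r` apart, and the corresponding zeros have pairwise distinct imaginary parts.)

## References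

* [SaiasWeingartner2009] E. Saias, A. Weingartner, *Zeros of Dirichlet series with periodic
  coefficients*, Acta Arith. 140 (2009), 335–344, §4 (last paragraph). Read (arXiv:0807.0783).
* [Titchmarsh1986] E. C. Titchmarsh, *The Theory of the Riemann Zeta-Function*, 2nd ed., §11.10
  (non-overlapping circles each containing an `a`-point).
-/

noncomputable section

open Complex Set Metric MeasureTheory
open scoped ENNReal

namespace Literature.NumberTheory.LFunctions

/-! ### Rouché via the maximum modulus principle -/

/-- **Zeros from uniform approximation (Rouché's theorem, maximum-modulus form).** Let `g` be
holomorphic on the open disc `|z − z₀| < r` and continuous on its closure, let `f : ℂ → ℂ` be any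
function with `f z₀ = 0` and `δ ≤ |f z|` on the circle `|z − z₀| = r`, and suppose
`|g z − f z| < δ/2` on the closed disc. Then `g` has a zero in the open disc. [folklore] -/
theorem exists_zero_of_norm_sub_lt {f g : ℂ → ℂ} {z₀ : ℂ} {r δ : ℝ} (hr : 0 < r)
    (hg : DiffContOnCl ℂ g (ball z₀ r)) (hf0 : f z₀ = 0) (hδ : ∀ z ∈ sphere z₀ r, δ ≤ ‖f z‖)
    (hclose : ∀ z ∈ closedBall z₀ r, ‖g z - f z‖ < δ / 2) :
    ∃ z ∈ ball z₀ r, g z = 0 := by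
  have h0 : ‖g z₀‖ < δ / 2 := by simpa [hf0] using hclose z₀ (mem_closedBall_self hr.le)
  have hδpos : 0 < δ := by linarith [norm_nonneg (g z₀)]
  by_contra hcon
  push Not at hcon
  -- `g` is bounded below by `δ / 2` on the circle
  have hsph : ∀ z ∈ sphere z₀ r, δ / 2 < ‖g z‖ := by
    intro z hz
    have h1 := hclose z (sphere_subset_closedBall hz)
    have h2 := norm_sub_norm_le (f z) (g z)
    rw [norm_sub_rev] at h1
    linarith [hδ z hz]
  -- `g` is zero-free on the closed disc
  have hne : ∀ z ∈ closure (ball z₀ r), g z ≠ 0 := by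
    intro z hz
    rw [closure_ball z₀ hr.ne'] at hz
    rcases eq_or_lt_of_le (mem_closedBall.1 hz) with h | h
    · intro hz0
      have := hsph z (mem_sphere.2 h)
      rw [hz0, norm_zero] at this
      linarith
    · exact hcon z (mem_ball.2 h)
  have hinv : DiffContOnCl ℂ g⁻¹ (ball z₀ r) := hg.inv hne
  -- maximum modulus for `1 / g`
  have hbound : ∀ z ∈ frontier (ball z₀ r), ‖g⁻¹ z‖ ≤ (δ / 2)⁻¹ := by
    intro z hz
    rw [frontier_ball z₀ hr.ne'] at hz
    rw [Pi.inv_apply, norm_inv]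
    exact inv_anti₀ (by positivity) (hsph z hz).le
  have hz₀ : z₀ ∈ closure (ball z₀ r) := subset_closure (mem_ball_self hr)
  have key := norm_le_of_forall_mem_frontier_norm_le isBounded_ball hinv hbound hz₀
  rw [Pi.inv_apply, norm_inv] at key
  have hpos : 0 < ‖g z₀‖ := norm_pos_iff.2 (hne z₀ hz₀)
  have := (inv_le_inv₀ hpos (by positivity)).1 key
  linarith

/-! ### Counting distinct zeros from a set of shifts of positive lower density -/

/-- Covering `[0, T']` by the intervals `[kr, (k+1)r)`, `k < ⌊T'/r⌋`, and the remainder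
`[⌊T'/r⌋ r, T']`. [folklore] -/
theorem Icc_subset_iUnion_Ico_union {r T' : ℝ} (hr : 0 < r) (A : Set ℝ) :
    A ∩ Icc 0 T' ⊆ (⋃ k ∈ Finset.range ⌊T' / r⌋₊, A ∩ Ico ((k : ℝ) * r) ((k + 1 : ℝ) * r)) ∪
      Icc ((⌊T' / r⌋₊ : ℝ) * r) T' := by
  rintro x ⟨hxA, hx0, hxT⟩
  by_cases hlt : x < (⌊T' / r⌋₊ : ℝ) * r
  · left
    simp only [mem_iUnion, Finset.mem_range, mem_inter_iff, Set.mem_Ico, exists_prop]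
    refine ⟨⌊x / r⌋₊, ?_, hxA, ?_, ?_⟩
    · have h1 : (⌊x / r⌋₊ : ℝ) ≤ x / r := Nat.floor_le (div_nonneg hx0 hr.le)
      have h2 : x / r < ⌊T' / r⌋₊ := by rwa [div_lt_iff₀ hr]
      exact_mod_cast h1.trans_lt h2
    · have h1 : (⌊x / r⌋₊ : ℝ) ≤ x / r := Nat.floor_le (div_nonneg hx0 hr.le)
      rwa [le_div_iff₀ hr] at h1
    · have h1 : x / r < ⌊x / r⌋₊ + 1 := Nat.lt_floor_add_one _
      rwa [div_lt_iff₀ hr] at h1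
  · right
    exact ⟨not_lt.1 hlt, hxT⟩

open Classical in
/-- **Many blocks meet a set of positive measure.** If `meas(A ∩ [0, T']) ≥ δT'`, then among the
`⌊T'/r⌋` blocks `[kr, (k+1)r)` at least `δT'/r − 1` meet `A`. [folklore] -/
theorem le_card_filter_nonempty {A : Set ℝ} {δ r T' : ℝ} (hr : 0 < r)
    (hA : ENNReal.ofReal (δ * T') ≤ volume (A ∩ Icc 0 T')) :
    δ * T' / r - 1 ≤
      ((Finset.range ⌊T' / r⌋₊).filter
        fun k : ℕ ↦ (A ∩ Ico ((k : ℝ) * r) ((k + 1 : ℝ) * r)).Nonempty).card := by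
  set N := ⌊T' / r⌋₊ with hN
  set I : ℕ → Set ℝ := fun k ↦ Ico ((k : ℝ) * r) ((k + 1 : ℝ) * r) with hI
  set good := (Finset.range N).filter fun k : ℕ ↦ (A ∩ I k).Nonempty with hgood
  -- measure of each piece
  have hblock : ∀ k ∈ Finset.range N,
      volume (A ∩ I k) ≤ if (A ∩ I k).Nonempty then ENNReal.ofReal r else 0 := by
    intro k _
    split_ifs with h
    · calc volume (A ∩ I k) ≤ volume (I k) := measure_mono inter_subset_right
        _ = ENNReal.ofReal r := by
          simp only [hI, Real.volume_Ico]
          congr 1; ring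
    · rw [Set.not_nonempty_iff_eq_empty.1 h, measure_empty]
  have hrem : volume (Icc ((N : ℝ) * r) T') ≤ ENNReal.ofReal r := by
    rw [Real.volume_Icc]
    refine ENNReal.ofReal_le_ofReal ?_
    have h1 : T' / r < N + 1 := Nat.lt_floor_add_one _
    rw [div_lt_iff₀ hr] at h1
    linarith
  have hcover := Icc_subset_iUnion_Ico_union hr A (T' := T')
  have hsum : volume (A ∩ Icc 0 T') ≤
      (good.card : ℝ≥0∞) * ENNReal.ofReal r + ENNReal.ofReal r := by
    calc volume (A ∩ Icc 0 T')
        ≤ volume ((⋃ k ∈ Finset.range N, A ∩ I k) ∪ Icc ((N : ℝ) * r) T') := measure_mono hcover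
      _ ≤ volume (⋃ k ∈ Finset.range N, A ∩ I k) + volume (Icc ((N : ℝ) * r) T') :=
          measure_union_le _ _
      _ ≤ (∑ k ∈ Finset.range N, volume (A ∩ I k)) + ENNReal.ofReal r :=
          add_le_add (measure_biUnion_finset_le _ _) hrem
      _ ≤ (∑ k ∈ Finset.range N, if (A ∩ I k).Nonempty then ENNReal.ofReal r else 0) +
            ENNReal.ofReal r := add_le_add (Finset.sum_le_sum hblock) le_rfl
      _ = (good.card : ℝ≥0∞) * ENNReal.ofReal r + ENNReal.ofReal r := by
          rw [Finset.sum_ite, Finset.sum_const_zero, add_zero, Finset.sum_const, nsmul_eq_mul]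
  have hreal : δ * T' ≤ good.card * r + r := by
    have h1 := hA.trans hsum
    have h2 : (good.card : ℝ≥0∞) * ENNReal.ofReal r + ENNReal.ofReal r =
        ENNReal.ofReal (good.card * r + r) := by
      rw [ENNReal.ofReal_add (by positivity) hr.le, ENNReal.ofReal_mul' hr.le]
      simp
    rw [h2] at h1
    exact (ENNReal.ofReal_le_ofReal_iff (by positivity)).1 h1
  rw [div_sub_one hr.ne', div_le_iff₀ hr]
  linarith

/-- **From shifts of positive lower density to `≫ T` distinct zeros** ("by the positive lower
density of these `t`, we conclude that `N'_F(σ₁, σ₂, T) ≫ T`"). Let `A ⊆ ℝ` satisfy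
`meas(A ∩ [0, T]) ≥ δT` for all `T ≥ T₁` (`δ > 0`), and suppose that for every `τ ∈ A` the
function `F` has a zero `z` with `|Re z − σ| < r` and `|Im z − (τ + t₀)| < r`. Then there are
`c > 0` and `T₀` such that for every `T ≥ T₀` there is a finite set of at least `cT` (distinct)
zeros of `F` with `|Re z − σ| < r` and `|Im z| ≤ T`. [cite: SaiasWeingartner2009, §4] -/
theorem exists_finset_zeros_of_density {F : ℂ → ℂ} {A : Set ℝ} {δ T₁ : ℝ} (hδ : 0 < δ)
    (hA : ∀ T : ℝ, T₁ ≤ T → ENNReal.ofReal (δ * T) ≤ volume (A ∩ Icc 0 T))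
    {σ r t₀ : ℝ} (hr : 0 < r)
    (hzero : ∀ τ ∈ A, ∃ z : ℂ, F z = 0 ∧ |z.re - σ| < r ∧ |z.im - (τ + t₀)| < r) :
    ∃ c : ℝ, 0 < c ∧ ∃ T₀ : ℝ, ∀ T : ℝ, T₀ ≤ T →
      ∃ Z : Finset ℂ, c * T ≤ Z.card ∧ ∀ z ∈ Z, |z.re - σ| < r ∧ |z.im| ≤ T ∧ F z = 0 := by
  classical
  -- the slack `S = |t₀| + r` and the constants
  set S : ℝ := |t₀| + r with hS
  have hS0 : 0 ≤ S := by positivity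
  refine ⟨δ / (18 * r), by positivity, max (max T₁ 0 + S) (2 * S + 18 * r / δ), fun T hT ↦ ?_⟩
  set T' : ℝ := T - S with hT'
  have hT'₁ : T₁ ≤ T' := by
    have := (le_max_left _ _).trans hT
    rw [hT']; linarith [le_max_left T₁ 0]
  have hT'0 : 0 ≤ T' := by
    have := (le_max_left _ _).trans hT
    rw [hT']; linarith [le_max_right T₁ 0]
  have hT2 : 2 * S + 18 * r / δ ≤ T := (le_max_right _ _).trans hT
  -- blocks and good blocks
  set N := ⌊T' / r⌋₊ with hN
  set I : ℕ → Set ℝ := fun k ↦ Ico ((k : ℝ) * r) ((k + 1 : ℝ) * r) with hI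
  set good := (Finset.range N).filter fun k ↦ (A ∩ I k).Nonempty with hgood
  have hcard : δ * T' / r - 1 ≤ good.card := le_card_filter_nonempty hr (hA T' hT'₁)
  -- pigeonhole into residues mod 3
  obtain ⟨j, -, hj⟩ : ∃ j ∈ Finset.range 3, good.card / 3 ≤ (good.filter fun k ↦ k % 3 = j).card :=
    Finset.exists_le_card_fiber_of_mul_le_card_of_maps_to
      (fun k _ ↦ Finset.mem_range.2 (Nat.mod_lt k three_pos)) ⟨0, by simp⟩
      (by simp [Nat.mul_div_le])
  set goodj := good.filter fun k ↦ k % 3 = j with hgoodj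
  -- choices: a shift in each good block and a zero for each shift
  set τf : ℕ → ℝ := fun k ↦ if h : (A ∩ I k).Nonempty then h.some else 0 with hτf
  have hτf : ∀ k ∈ goodj, τf k ∈ A ∧ (k : ℝ) * r ≤ τf k ∧ τf k < (k + 1) * r := by
    intro k hk
    have hk' : (A ∩ I k).Nonempty := (Finset.mem_filter.1 (Finset.mem_filter.1 hk).1).2
    have hmem := hk'.some_mem
    simp only [hτf, dif_pos hk']
    exact ⟨hmem.1, hmem.2.1, hmem.2.2⟩
  set zf : ℕ → ℂ := fun k ↦ if h : τf k ∈ A then (hzero _ h).choose else 0 with hzf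
  have hzf : ∀ k ∈ goodj, F (zf k) = 0 ∧ |(zf k).re - σ| < r ∧ |(zf k).im - (τf k + t₀)| < r := by
    intro k hk
    have h := (hτf k hk).1
    simp only [hzf, dif_pos h]
    exact (hzero _ h).choose_spec
  -- the imaginary parts are strictly increasing along `goodj`
  have hmono : StrictMonoOn (fun k ↦ (zf k).im) goodj := by
    intro k hk k' hk' hlt
    have hkk' : k + 3 ≤ k' := by
      have h1 : k % 3 = j := (Finset.mem_filter.1 hk).2
      have h2 : k' % 3 = j := (Finset.mem_filter.1 hk').2
      omega
    obtain ⟨-, -, hk1⟩ := hτf k hk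
    obtain ⟨-, hk'0, -⟩ := hτf k' hk'
    have hz := (abs_lt.1 (hzf k hk).2.2).2
    have hz' := (abs_lt.1 (hzf k' hk').2.2).1
    have hcast : (k : ℝ) + 3 ≤ k' := by exact_mod_cast hkk'
    have : ((k : ℝ) + 3) * r ≤ (k' : ℝ) * r := mul_le_mul_of_nonneg_right hcast hr.le
    show (zf k).im < (zf k').im
    nlinarith
  have hinj : Set.InjOn zf goodj := fun k hk k' hk' h ↦
    hmono.injOn hk hk' (by simpa using congrArg Complex.im h)
  -- the set of zeros
  refine ⟨goodj.image zf, ?_, ?_⟩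
  · rw [Finset.card_image_of_injOn hinj]
    have h3 : ((good.card : ℕ) : ℝ) / 3 - 1 ≤ ((good.card / 3 : ℕ) : ℝ) := by
      have := Nat.div_add_mod good.card 3
      have hmod : (good.card % 3 : ℕ) < 3 := Nat.mod_lt _ three_pos
      have h1 : ((good.card : ℕ) : ℝ) =
          3 * ((good.card / 3 : ℕ) : ℝ) + ((good.card % 3 : ℕ) : ℝ) := by
        exact_mod_cast this.symm
      have h2 : ((good.card % 3 : ℕ) : ℝ) ≤ 2 := by
        have : (good.card % 3 : ℕ) ≤ 2 := by omega
        exact_mod_cast this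
      rw [h1]; linarith
    have hj' : ((good.card / 3 : ℕ) : ℝ) ≤ goodj.card := by exact_mod_cast hj
    have hmain : δ * T' / r - 1 ≤ good.card := hcard
    -- `δ T / (18 r) ≤ (δ T'/r - 1)/3 - 1`
    have hrδ : 0 < r / δ := by positivity
    have hTS : T' = T - S := rfl
    have h4 : δ / (18 * r) * T ≤ (δ * T' / r - 1) / 3 - 1 := by
      rw [hTS]
      rw [div_mul_eq_mul_div, div_le_iff₀ (by positivity : (0 : ℝ) < 18 * r)]
      have e1 : ((δ * (T - S) / r - 1) / 3 - 1) * (18 * r) = 6 * δ * (T - S) - 24 * r := by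
        field_simp
        ring
      rw [e1]
      have h5 : 18 * r / δ * δ = 18 * r := by field_simp
      have h6 : δ * (2 * S + 18 * r / δ) ≤ δ * T := mul_le_mul_of_nonneg_left hT2 hδ.le
      nlinarith [h6, hδ, hr, hS0]
    linarith
  · intro z hz
    obtain ⟨k, hk, rfl⟩ := Finset.mem_image.1 hz
    obtain ⟨hF, hre, him⟩ := hzf k hk
    obtain ⟨-, hk0, hk1⟩ := hτf k hk
    refine ⟨hre, ?_, hF⟩
    have hkN : k < N := Finset.mem_range.1 (Finset.mem_filter.1 (Finset.mem_filter.1 hk).1).1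
    have hk1' : ((k : ℝ) + 1) * r ≤ T' := by
      have h1 : ((k : ℝ) + 1) ≤ N := by exact_mod_cast hkN
      have h2 : (N : ℝ) ≤ T' / r := Nat.floor_le (div_nonneg hT'0 hr.le)
      have := mul_le_mul_of_nonneg_right (h1.trans h2) hr.le
      rwa [div_mul_cancel₀ _ hr.ne'] at this
    have hτ0 : 0 ≤ τf k := le_trans (by positivity) hk0
    have him' := abs_lt.1 him
    rw [abs_le]
    constructor
    · have : -|t₀| ≤ t₀ := neg_abs_le t₀
      have hTS' : S ≤ T := by linarith
      linarith [him'.1]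
    · have : t₀ ≤ |t₀| := le_abs_self t₀
      linarith [him'.2]

end Literature.NumberTheory.LFunctions
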